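import Literature.AlgebraicGeometry.HodgeTheory.HodgeFiltrationWedgeOrthogonal
import Literature.Geometry.Kaehler.RiemannianHodgeStarStarProofs
import Literature.Geometry.Kaehler.HodgeStarIsometryProofs
import Literature.Geometry.Kaehler.RiemannianHodgeSmoothProofs
import HarnessLib

/-!
# The wedge pairing `∫_M α ∧ β` is bounded by the `L²` norms: `|∫_M α ∧ β| ≤ 2 ‖α‖ ‖β‖`

Topic: the `L²` metric on the forms of a compact oriented Riemannian manifold (Warner (1983), 6.1;
Voisin (2002), §5.1.1). Theorems only, no definition, no named fact. Written by the prover seat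
`hodge-nonav-prover-Bx` (g17, cell `hodge-nonav`) as brick **K5a** of the programme
«GRIFFITHS-HOLOMORPHY» (memo `PROGRAMME-GRIFFITHS-HOLOMORPHY-Bx-g17.md`): the continuity of the
bilinear pairing `(α, β) ↦ ∫_M α ∧ β` on `A^k(M; ℂ) × A^{n-k}(M; ℂ)` for the `L²` norms, which turns
the `L²`-continuity of transported harmonic representatives (bricks K0/K1) into the differentiability
of the test functionals (brick K5).

Warner (1983), 6.1 (2), (5), (6): `⟨α, β⟩_{L²} = ∫ α ∧ ⋆β`, `⋆⋆ = (-1)^{k(n-k)}`, `⋆` an isometry.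
Hence for REAL forms `a` (degree `k`) and `c` (degree `m`, `k + m = n`):
`∫ a ∧ c = ⟨a, (-1)^{km} ⋆c⟩_{L²}` and Cauchy–Schwarz gives `|∫ a ∧ c| ≤ ‖a‖ ‖⋆c‖ = ‖a‖ ‖c‖`
(`abs_integral_wedge_le`). For complex forms, expanding real and imaginary parts
(`re_wedge`, `im_wedge`) gives `|∫ α ∧ β| ≤ 2 ‖α‖ ‖β‖` (`norm_cintegral_wedge_le`).

## References

* F. W. Warner, *Foundations of Differentiable Manifolds and Lie Groups*, GTM 94 (1983), Ch. 2
  Ex. 13, §6.1 (pp. 220–221). [WarnerGTM94]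
* C. Voisin, *Hodge Theory and Complex Algebraic Geometry I*, CUP (2002), §5.1.1. [VoisinHodgeI2002]
-/

noncomputable section

open scoped Manifold ContDiff Topology
open Bundle Module Set Finset

namespace Literature.AlgebraicGeometry.HodgeTheory

open Literature.Geometry.Kaehler Literature.NumberTheory.Transcendental
  Literature.AlgebraicGeometry.Motives

-- `TangentSpace 𝓘(ℝ, E) x = E` silently, as in the tree's form files.
set_option backward.isDefEq.respectTransparency false

section RealImaginaryParts

variable {E : Type*} [NormedAddCommGroup E] [NormedSpace ℂ E]

/-- Pointwise: `Re (a ∧ b) = Re a ∧ Re b - Im a ∧ Im b` for complex-valued alternating maps (the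
shuffle formula, Warner (1983), 2.10 (b), read through `Re (xy) = Re x Re y - Im x Im y`).
[cite: WarnerGTM94, 2.10 (b)] -/
theorem reCLM_compContinuousAlternatingMap_wedge {k l : ℕ} (a : E [⋀^Fin k]→L[ℝ] ℂ)
    (b : E [⋀^Fin l]→L[ℝ] ℂ) :
    Complex.reCLM.compContinuousAlternatingMap (a.wedge b) =
      (Complex.reCLM.compContinuousAlternatingMap a).wedge (Complex.reCLM.compContinuousAlternatingMap b) -
        (Complex.imCLM.compContinuousAlternatingMap a).wedge
          (Complex.imCLM.compContinuousAlternatingMap b) := by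
  ext v
  simp only [ContinuousLinearMap.compContinuousAlternatingMap_coe, Function.comp_apply,
    Complex.reCLM_apply, Complex.imCLM_apply, ContinuousAlternatingMap.sub_apply,
    ContinuousAlternatingMap.wedge_apply, Complex.real_smul, Complex.re_ofReal_mul, Complex.re_sum,
    smul_eq_mul, Finset.mul_sum, ← Finset.sum_sub_distrib, ← mul_sub]
  refine Finset.sum_congr rfl fun σ _ ↦ ?_
  rw [Units.smul_def, Units.smul_def, Units.smul_def, zsmul_eq_mul, zsmul_eq_mul, zsmul_eq_mul]
  simp only [Complex.mul_re, Complex.mul_im, Complex.intCast_re, Complex.intCast_im, zero_mul,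
    sub_zero]
  ring

/-- Pointwise: `Im (a ∧ b) = Re a ∧ Im b + Im a ∧ Re b`. [cite: WarnerGTM94, 2.10 (b)] -/
theorem imCLM_compContinuousAlternatingMap_wedge {k l : ℕ} (a : E [⋀^Fin k]→L[ℝ] ℂ)
    (b : E [⋀^Fin l]→L[ℝ] ℂ) :
    Complex.imCLM.compContinuousAlternatingMap (a.wedge b) =
      (Complex.reCLM.compContinuousAlternatingMap a).wedge (Complex.imCLM.compContinuousAlternatingMap b) +
        (Complex.imCLM.compContinuousAlternatingMap a).wedge
          (Complex.reCLM.compContinuousAlternatingMap b) := by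
  ext v
  simp only [ContinuousLinearMap.compContinuousAlternatingMap_coe, Function.comp_apply,
    Complex.reCLM_apply, Complex.imCLM_apply, ContinuousAlternatingMap.add_apply,
    ContinuousAlternatingMap.wedge_apply, Complex.real_smul, Complex.im_ofReal_mul, Complex.im_sum,
    smul_eq_mul, Finset.mul_sum, ← Finset.sum_add_distrib, ← mul_add]
  refine Finset.sum_congr rfl fun σ _ ↦ ?_
  rw [Units.smul_def, Units.smul_def, Units.smul_def, zsmul_eq_mul, zsmul_eq_mul, zsmul_eq_mul]
  simp only [Complex.mul_re, Complex.mul_im, Complex.intCast_re, Complex.intCast_im, zero_mul,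
    add_zero]
  ring

variable {M : Type*} [TopologicalSpace M] [ChartedSpace E M]

/-- **Real part of a wedge product of forms**: `Re(α ∧ β) = Re α ∧ Re β - Im α ∧ Im β`.
[cite: WarnerGTM94, 2.10 (b)] -/
theorem re_wedge {k l : ℕ} (α : MForm 𝓘(ℝ, E) M ℂ k) (β : MForm 𝓘(ℝ, E) M ℂ l) :
    (α.wedge β).re = α.re.wedge β.re - α.im.wedge β.im := by
  funext x
  change Complex.reCLM.compContinuousAlternatingMap
      ((show E [⋀^Fin k]→L[ℝ] ℂ from α x).wedge (show E [⋀^Fin l]→L[ℝ] ℂ from β x)) = _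
  rw [reCLM_compContinuousAlternatingMap_wedge]
  rfl

/-- **Imaginary part of a wedge product of forms**: `Im(α ∧ β) = Re α ∧ Im β + Im α ∧ Re β`.
[cite: WarnerGTM94, 2.10 (b)] -/
theorem im_wedge {k l : ℕ} (α : MForm 𝓘(ℝ, E) M ℂ k) (β : MForm 𝓘(ℝ, E) M ℂ l) :
    (α.wedge β).im = α.re.wedge β.im + α.im.wedge β.re := by
  funext x
  change Complex.imCLM.compContinuousAlternatingMap
      ((show E [⋀^Fin k]→L[ℝ] ℂ from α x).wedge (show E [⋀^Fin l]→L[ℝ] ℂ from β x)) = _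
  rw [imCLM_compContinuousAlternatingMap_wedge]
  rfl

end RealImaginaryParts

section Bound

variable {E : Type*} [NormedAddCommGroup E] [NormedSpace ℂ E] [FiniteDimensional ℂ E]
  [MeasurableSpace E] [BorelSpace E]
  {M : Type*} [TopologicalSpace M] [ChartedSpace E M] [IsManifold 𝓘(ℝ, E) ∞ M]
  [T2Space M] [CompactSpace M] {n : ℕ} [Fact (finrank ℝ E = n)]
  [RiemannianBundle (fun x : M ↦ TangentSpace 𝓘(ℝ, E) x)]
  [IsContMDiffRiemannianBundle 𝓘(ℝ, E) ∞ E (fun x : M ↦ TangentSpace 𝓘(ℝ, E) x)]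
  (o : (x : M) → Orientation ℝ (TangentSpace 𝓘(ℝ, E) x) (Fin n))

/-- **`|∫_M a ∧ c| ≤ ‖a‖_{L²} ‖c‖_{L²}` for real forms** of complementary degrees on a compact
oriented Riemannian manifold (smooth metric, smooth volume form): `∫ a ∧ c = ⟨a, (-1)^{km} ⋆c⟩_{L²}`
(Warner (1983), 6.1 (2), (5): `⟨α, β⟩ = ∫ α ∧ ⋆β`, `⋆⋆ = (-1)^{km}`), Cauchy–Schwarz, and `⋆` is an
`L²`-isometry (Ex. 2.13). [cite: WarnerGTM94, §6.1 (2), (5), p. 220] -/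
theorem abs_integral_wedge_le (ho : IsSmoothForm (riemannianVolumeForm o)) {k m : ℕ}
    (h : k + m = n) {a : MForm 𝓘(ℝ, E) M ℝ k} {c : MForm 𝓘(ℝ, E) M ℝ m} (ha : IsSmoothForm a)
    (hc : IsSmoothForm c) :
    |MForm.integral o ((a.wedge c).castDeg h)| ≤
      Real.sqrt (MForm.l2Inner o a a) * Real.sqrt (MForm.l2Inner o c c) := by
  have h' : m + k = n := by omega
  -- `b := (-1)^{km} ⋆c` has `⋆b = c`
  set b : MForm 𝓘(ℝ, E) M ℝ k := ((-1 : ℝ) ^ (k * m)) • MForm.hodgeStar o h' c with hb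
  have hbs : IsSmoothForm b := (IsSmoothForm.hodgeStar o ho h' hc).smul _
  have hstar : MForm.hodgeStar o h b = c := by
    rw [hb, map_smul, MForm.hodgeStar_hodgeStar_holds o h' h c, smul_smul, Nat.mul_comm m k,
      ← pow_add, ← two_mul, pow_mul, neg_one_sq, one_pow, one_smul]
  -- `∫ a ∧ c = ⟨a, b⟩`
  have hint : MForm.integral o ((a.wedge c).castDeg h) = MForm.l2Inner o a b := by
    rw [MForm.l2Inner_eq_integral_wedge_hodgeStar_holds o h a b, hstar]
  -- `⟨b, b⟩ = ⟨c, c⟩`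
  have hbb : MForm.l2Inner o b b = MForm.l2Inner o c c := by
    have h1 : MForm.l2Inner o b b = MForm.l2Inner o (MForm.hodgeStar o h' c) (MForm.hodgeStar o h' c) := by
      rw [hb, MForm.l2Inner_smul_left, MForm.l2Inner_symm, MForm.l2Inner_smul_left, ← mul_assoc,
        Nat.mul_comm k m, ← pow_add, ← two_mul, pow_mul, neg_one_sq, one_pow, one_mul]
    rw [h1]
    unfold MForm.l2Inner MForm.inner
    congr 1
    funext x
    rw [MForm.hodgeStar_apply, alternatingFormInner_hodgeStar_hodgeStar_holds (o x) h' (c x) (c x)]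
  rw [hint, ← hbb]
  exact ha.abs_l2Inner_le o hbs ho

/-- **`|∫_M α ∧ β| ≤ 2 ‖α‖_{L²} ‖β‖_{L²}` for complex forms** of complementary degrees on a compact
oriented Riemannian manifold (`vol_o` smooth): the wedge pairing is continuous for the `L²` norms of
`CL2SmoothForms`. From the real case on the four combinations of real and imaginary parts
(`re_wedge`, `im_wedge`) and `(x + y)² ≤ 2(x² + y²)`. [cite: WarnerGTM94, §6.1 (2), (5), p. 220]
[cite: VoisinHodgeI2002, §5.1.1, eq. (5.1)] -/
theorem norm_cintegral_wedge_le (ho : IsSmoothForm (riemannianVolumeForm o)) {k m : ℕ}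
    (h : k + m = n) {α : MForm 𝓘(ℝ, E) M ℂ k} {β : MForm 𝓘(ℝ, E) M ℂ m} (hα : IsSmoothForm α)
    (hβ : IsSmoothForm β) :
    haveI : Fact (IsSmoothForm (riemannianVolumeForm o)) := ⟨ho⟩
    ‖cintegral o ((α.wedge β).castDeg h)‖ ≤
      2 * ‖CL2SmoothForms.mk o α hα‖ * ‖CL2SmoothForms.mk o β hβ‖ := by
  haveI : Fact (IsSmoothForm (riemannianVolumeForm o)) := ⟨ho⟩
  haveI : IsContinuousRiemannianBundle E (fun x : M ↦ TangentSpace 𝓘(ℝ, E) x) :=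
    isContinuousRiemannianBundle_of_isContMDiffRiemannianBundle 𝓘(ℝ, E) ∞
  haveI : WedgeFacts 𝓘(ℝ, E) M ℝ := wedgeFacts_discharged _ _ ℝ
  -- the four real pairings
  set A := Real.sqrt (MForm.l2Inner o α.re α.re) with hA
  set B := Real.sqrt (MForm.l2Inner o α.im α.im) with hB
  set C := Real.sqrt (MForm.l2Inner o β.re β.re) with hC
  set D := Real.sqrt (MForm.l2Inner o β.im β.im) with hD
  have hA0 : 0 ≤ A := Real.sqrt_nonneg _
  have hB0 : 0 ≤ B := Real.sqrt_nonneg _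
  have hC0 : 0 ≤ C := Real.sqrt_nonneg _
  have hD0 : 0 ≤ D := Real.sqrt_nonneg _
  have h1 := abs_integral_wedge_le o ho h hα.re hβ.re
  have h2 := abs_integral_wedge_le o ho h hα.im hβ.im
  have h3 := abs_integral_wedge_le o ho h hα.re hβ.im
  have h4 := abs_integral_wedge_le o ho h hα.im hβ.re
  -- real and imaginary parts of the complex integral
  have hre : (cintegral o ((α.wedge β).castDeg h)).re =
      MForm.integral o ((α.re.wedge β.re).castDeg h) - MForm.integral o ((α.im.wedge β.im).castDeg h) := by
    subst h
    rw [re_cintegral, MForm.castDeg_rfl, MForm.castDeg_rfl, MForm.castDeg_rfl, re_wedge,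
      sub_eq_add_neg, ← neg_one_smul ℝ (α.im.wedge β.im),
      MForm.integral_add_holds (o := o)
        (isContinuousOrientation_of_isSmoothForm_riemannianVolumeForm_holds o ho)
        (isSmoothForm_wedge hα.re hβ.re) ((isSmoothForm_wedge hα.im hβ.im).smul _),
      MForm.integral_smul, neg_one_mul, ← sub_eq_add_neg]
  have him : (cintegral o ((α.wedge β).castDeg h)).im =
      MForm.integral o ((α.re.wedge β.im).castDeg h) + MForm.integral o ((α.im.wedge β.re).castDeg h) := by
    subst h
    rw [im_cintegral, MForm.castDeg_rfl, MForm.castDeg_rfl, MForm.castDeg_rfl, im_wedge,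
      MForm.integral_add_holds (o := o)
        (isContinuousOrientation_of_isSmoothForm_riemannianVolumeForm_holds o ho)
        (isSmoothForm_wedge hα.re hβ.im) (isSmoothForm_wedge hα.im hβ.re)]
  -- `|z| ≤ |Re z| + |Im z|`
  have hz : ‖cintegral o ((α.wedge β).castDeg h)‖ ≤ (A * C + B * D) + (A * D + B * C) := by
    refine (Complex.norm_le_abs_re_add_abs_im _).trans ?_
    rw [hre, him]
    refine add_le_add ((abs_sub _ _).trans (add_le_add h1 h2)) ((abs_add_le _ _).trans (add_le_add h3 h4))
  -- the `L²` norms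
  have hnα : ‖CL2SmoothForms.mk o α hα‖ ^ 2 = A ^ 2 + B ^ 2 := by
    rw [CL2SmoothForms.norm_mk_sq_eq_add, hA, hB, Real.sq_sqrt (hα.re.l2Inner_self_nonneg' o ho),
      Real.sq_sqrt (hα.im.l2Inner_self_nonneg' o ho)]
  have hnβ : ‖CL2SmoothForms.mk o β hβ‖ ^ 2 = C ^ 2 + D ^ 2 := by
    rw [CL2SmoothForms.norm_mk_sq_eq_add, hC, hD, Real.sq_sqrt (hβ.re.l2Inner_self_nonneg' o ho),
      Real.sq_sqrt (hβ.im.l2Inner_self_nonneg' o ho)]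
  have hNα : 0 ≤ ‖CL2SmoothForms.mk o α hα‖ := norm_nonneg _
  have hNβ : 0 ≤ ‖CL2SmoothForms.mk o β hβ‖ := norm_nonneg _
  -- `(A + B)(C + D) ≤ 2 ‖α‖ ‖β‖`
  set X := ‖CL2SmoothForms.mk o α hα‖ with hX
  set Y := ‖CL2SmoothForms.mk o β hβ‖ with hY
  have hs2 : 0 ≤ Real.sqrt 2 := Real.sqrt_nonneg _
  have hsum : (A * C + B * D) + (A * D + B * C) = (A + B) * (C + D) := by ring
  have hAB : A + B ≤ Real.sqrt 2 * X := by
    have h2 : (A + B) ^ 2 ≤ (Real.sqrt 2 * X) ^ 2 := by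
      rw [mul_pow, Real.sq_sqrt (by norm_num : (0:ℝ) ≤ 2), hnα]
      nlinarith [sq_nonneg (A - B)]
    exact (pow_le_pow_iff_left₀ (add_nonneg hA0 hB0) (mul_nonneg hs2 hNα) two_ne_zero).1 h2
  have hCD : C + D ≤ Real.sqrt 2 * Y := by
    have h2 : (C + D) ^ 2 ≤ (Real.sqrt 2 * Y) ^ 2 := by
      rw [mul_pow, Real.sq_sqrt (by norm_num : (0:ℝ) ≤ 2), hnβ]
      nlinarith [sq_nonneg (C - D)]
    exact (pow_le_pow_iff_left₀ (add_nonneg hC0 hD0) (mul_nonneg hs2 hNβ) two_ne_zero).1 h2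
  have h22 : Real.sqrt 2 * Real.sqrt 2 = 2 := Real.mul_self_sqrt (by norm_num)
  calc ‖cintegral o ((α.wedge β).castDeg h)‖ ≤ (A + B) * (C + D) := by rw [← hsum]; exact hz
    _ ≤ (Real.sqrt 2 * X) * (Real.sqrt 2 * Y) :=
        mul_le_mul hAB hCD (add_nonneg hC0 hD0) (mul_nonneg hs2 hNα)
    _ = (Real.sqrt 2 * Real.sqrt 2) * X * Y := by ring
    _ = 2 * X * Y := by rw [h22]

end Bound

end Literature.AlgebraicGeometry.HodgeTheory

end
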